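import Summits.NavierStokesRegularity.NavierStokesRegularity.Theses.TypeIIInviscidRelaxation
import Summits.NavierStokesRegularity.NavierStokesRegularity.Theorems.TypeIIInviscidRelaxationAxisymSwirlRegularCoreStrainNearTop
import HarnessLib

/-!
# Line `sub_typeI_core_compression` for crux `OneSidedRadialCriterion` (stmt-NavierStokesRegularity-19059)

LINE-FIRST SKELETON (linewriter-ns-typeiiinviscid-1, g1 — second variant; g0 registered
`parabolic_core_partial_typeI`, the velocity-envelope door).  The crux: an axisymmetric classical Leray–Hopf
solution on `[0,T)` (bounded on closed sub-slabs, rapidly decaying datum) with the one-sided gate `r u_r ≥ -Cν` on an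
axis tube `{r < δ}` extends smoothly past `T`.

IDEA (the strain-rate door).  The tree theorem
`RadialInflowCoreStrain.oneSidedRadialCriterion_of_coreStrain_nearTop C` (Theorems/…CoreStrainNearTop.lean) says:
for constants `ξ₀(C), κ₀(C) > 0` depending only on the gate constant, the crux follows once the ONE-SIDED RADIAL
STRAIN obeys the Type-I rate `u_r ≥ -κ₀ r/(T-t)` at the core points `0 < r < δ`, `r < ξ₀√(ν(T-t))`, from SOME time
`T₁ < T` on.  The constants are opaque (nested existentials through Leray similarity), so the usable research
statement is the one uniform in the core width and the rate:

  `stub_subTypeICoreCompression` [research, L]: for EVERY `ξ, κ > 0` there is `T₁ < T` with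
  `u_r(t,x) ≥ -κ·r/(T-t)` whenever `T₁ ≤ t < T`, `0 < r < δ`, `r < ξ√(ν(T-t))`,

i.e. `(T-t)·sup_{core} (u_r)⁻/r → 0`: the one-sided radial compression rate in every viscous-parabolic core is
`o(1/(T-t))` (SUB-TYPE-I).  On the axis this is the statement that the axial stretching `∂_z u_z(t,0,z) = -2·lim u_r/r`
is one-sidedly `o(1/(T-t))`.  NECESSITY: a solution smooth past `T` with `‖∇u‖ ≤ G` on the tube near `T` has
`u_r ≥ -G r ≥ -κ r/(T-t)` as soon as `T - t ≤ κ/G`, for every `κ`; so the stub is EQUIVALENT to the crux given the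
tree (no strength is lost by the `∀ ξ κ`).  Its negation is the blow-up signature recorded in the tree as
`RadialInflowCoreStrain.recurrent_coreCompression_of_not_hasSmoothExtensionPast` (Type-I-rate radial compression AND
Type-I-size gradient recur in the parabolic core).

Relation to g0's door: the strain clause implies Zhang's envelope (`r < ξ√(ν(T-t))` ⇒ `κ r/(T-t) < κξ√ν/√(T-t)`),
so a prover who closes this stub closes `parabolic_core_partial_typeI.stub_corePartialTypeI` too; the converse is
not formal.  This door is for hands that control VELOCITY GRADIENTS (strain / vortex stretching on the axis:
KNSS2009 §5, Chen–Fang–Zhang-type axis estimates, LeiZhang2017 criticality of `b = u_r e_r + u_z e_z`), the g0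
door for hands that control the VELOCITY (Zhang 2026 partial Type I).

Registered stub: `stub_subTypeICoreCompression` [research, L].  The composition `OneSidedRadialCriterion_of` is
sorry-free outside the stub (it instantiates the stub at the tree's `ξ₀(C), κ₀(C)`).
-/

namespace Summit.NavierStokesRegularity.NavierStokesRegularity.Cruxes.OneSidedRadialCriterion.SubTypeICoreCompression

open Set Real
open Literature.Analysis.FluidPDE
open Summit.NavierStokesRegularity.NavierStokesRegularity.Theorems
open Summit.NavierStokesRegularity.NavierStokesRegularity.Theorems.RadialInflowCoreStrain

-- the problem directory repeats the summit name (`NavierStokesRegularity/NavierStokesRegularity`)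
set_option linter.dupNamespace false

/-- **stub_subTypeICoreCompression** [research, L — the whole content of the crux after localisation to the
parabolic core, in STRAIN-RATE currency].
Under the crux's hypotheses (classical on `[0,T)`, Leray–Hopf, bounded on closed sub-slabs, axisymmetric slices,
rapidly decaying datum) and the gate `r u_r ≥ -Cν` on `{r < δ} × [0,T)`: for every core width `ξ > 0` and every
rate `κ > 0` there is a time `T₁ < T` from which on the one-sided radial strain bound `u_r ≥ -κ r/(T-t)` holds at
all core points `0 < r < δ`, `r < ξ√(ν(T-t))`.  (Sub-Type-I one-sided radial compression; necessary for every
solution smooth past `T`.)  Why it might fail: at gate constants `C ≥ 2` nothing known prevents a focusing event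
carrying `u_r ≈ -Cν/r` down to the Kolmogorov radius `r ∼ ν/‖u‖_∞ ≪ √(ν(T-t))` (a Type-II core), where
`Cν/r² ≫ κ/(T-t)`; the linear swirl comparison gives no modulus there (tree: `RadialInflowCriticalSink.not_uniform_modulus`).
Sources: KNSS2009 (arXiv:0709.3599) Thm 5.3 + §5; LeiZhang2017 (arXiv:1505.04311); Zhang 2026 (arXiv:2604.07785) Thm 1.1;
tree `RadialInflowCoreStrain.exists_coreStrain_tube_nearTop`. -/
theorem stub_subTypeICoreCompression {ν T : ℝ} (hν : 0 < ν) (hT : 0 < T)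
    {u : ℝ → EuclideanSpace ℝ (Fin 3) → EuclideanSpace ℝ (Fin 3)} {p : ℝ → EuclideanSpace ℝ (Fin 3) → ℝ}
    (hcl : IsClassicalNSSolutionOn (Ico 0 T) ν 0 u p) (hLH : IsLerayHopfOn T ν 0 (u 0) u)
    (hbd : ∀ T' < T, ∃ M : ℝ, ∀ t ∈ Icc 0 T', ∀ x, ‖u t x‖ ≤ M)
    (hax : ∀ t ∈ Ico 0 T, IsAxisymmetric (u t)) (hdec : HasRapidSpatialDecay (u 0))
    {C δ : ℝ} (hδ : 0 < δ)
    (hgate : ∀ t ∈ Ico 0 T, ∀ x : EuclideanSpace ℝ (Fin 3), cylRadius x < δ →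
      -(C * ν) ≤ x 0 * u t x 0 + x 1 * u t x 1)
    {ξ κ : ℝ} (hξ : 0 < ξ) (hκ : 0 < κ) :
    ∃ T₁ : ℝ, T₁ < T ∧ ∀ t ∈ Ico 0 T, T₁ ≤ t → ∀ x : EuclideanSpace ℝ (Fin 3), 0 < cylRadius x →
      cylRadius x < δ → cylRadius x < ξ * √(ν * (T - t)) →
        -(κ * cylRadius x / (T - t)) ≤ radialVelocity (u t) x := by
  sorry

/-- **Composition** (sorry-free outside the stub): the crux `OneSidedRadialCriterion` BY NAME, from
`stub_subTypeICoreCompression` instantiated at the tree constants `ξ₀(C), κ₀(C)` of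
`RadialInflowCoreStrain.oneSidedRadialCriterion_of_coreStrain_nearTop C`. -/
theorem OneSidedRadialCriterion_of :
    Summit.NavierStokesRegularity.NavierStokesRegularity.Theses.TypeIIInviscidRelaxation.OneSidedRadialCriterion := by
  intro ν T hν hT u p hcl hLH hbd hax hdec hin
  obtain ⟨C, δ, hδ, hgate⟩ := hin
  obtain ⟨ξ₀, κ₀, hξ₀, hκ₀, H⟩ := oneSidedRadialCriterion_of_coreStrain_nearTop C
  obtain ⟨T₁, hT₁, hstrain⟩ :=
    stub_subTypeICoreCompression hν hT hcl hLH hbd hax hdec hδ hgate hξ₀ hκ₀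
  exact H ν T hν hT u p hcl hLH hbd hax hdec δ hδ hgate T₁ hT₁ hstrain

end Summit.NavierStokesRegularity.NavierStokesRegularity.Cruxes.OneSidedRadialCriterion.SubTypeICoreCompression
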